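import Mathlib
import HarnessLib
import Summits.CriticalPhenomena.CardyFormulaZ2.Theses.CardySelfRefinement
import Literature.Probability.RandomPlanarGeometry.ChordalReversibility
import Literature.Probability.RandomPlanarGeometry.ConformalRectangle
import Literature.Probability.RandomPlanarGeometry.IsometryCovariance
import Literature.Probability.Percolation.IkhlefPonsaingFirstPassage
import Summits.CriticalPhenomena.CardyFormulaZ2.Theorems.CardySelfRefinementSymmetryUpgradeRTouchTwoScaleArm
import Summits.CriticalPhenomena.CardyFormulaZ2.Theorems.CardySelfRefinementSymmetryUpgradeRTouchInDomainArm

/-!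
# Upper lattice touch bound `P_{1/2}[interface within ε of z] ≤ C ε^{1/3}` at the diagonal flat
# wall of the triangle domain (conditional on Ikhlef–Ponsaing, Prop. 4.7)

Helper file for stub `stub_touchExponent` (S3) of line `SketchIdeatorTwo` of crux `SymmetryUpgradeR`
(stmt-CriticalPhenomena-17239, route CardySelfRefinement), stage T4b, part 2 (registered helper
`touchExponent_upperLatticeBound`).

For the triangle Dobrushin domain `(Δ; -1, -i)` of `touchExponent_triangleDomain`
(`Δ = {re < 0, im < 0, re + im > -1}`, wired arc the axis-parallel legs, free arc the hypotenuse)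
and ANY admissible `ℤ²`-discretisation family `E` of it, the probability that the bond-`ℤ²`
(`p = ½`) exploration interface of `(Δ, E δ)` comes `ε`-close to the midpoint `z = -(1+i)/2` of
the hypotenuse is `≤ C ε^{1/3}` for every `ε ∈ (0, 1/512)` and all small meshes `δ`, CONDITIONAL
on `Literature.Probability.Percolation.IkhlefPonsaingFirstPassage` (through T3,
`touchExponent_twoScaleArm`).

Proof. `z` is at distance `≥ 1/8` from the marked points and from the wired arc
(`touchExponent_z_far`), so for small `δ` the discrete marked points and the discrete wired arc
are far from `z` (`touchExponent_eventually_far`: Hausdorff convergence,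
`dist_meshPoint_ge_of_mem_zdDiscreteArc`). A visit to `B̄(z, ε)` then forces an `ω`-open path
through `Ω_δ ⊆ Δ` from `B̄(z, ε + δ)` to distance `≥ 1/64 - δ` (part 1,
`touchExponent_inDomainArm_of_visit`); near `z` the domain is the diagonal half-plane
`{v₀ + v₁ ≥ ⌊-1/δ⌋ + 1}`, and clipping the path at the levels `R₁ = ⌈2(ε+4δ)/δ⌉`,
`R₂ = ⌊(1/64-4δ)/(2δ)⌋` of the half-plane norm gives the two-scale diagonal arm event of T3
translated to that level (`touchExponent_clip_halfAnnulus`, `touchExponent_real_shift_level`);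
T3 bounds it by `C (R₁/R₂)^{1/3} ≤ C (2816 ε)^{1/3}` (`touchExponent_scales`).
-/

noncomputable section

namespace Summit.CriticalPhenomena.CardyFormulaZ2.Theorems.SymmetryUpgradeR.SwallowingSkeleton

open MeasureTheory Filter Set Metric
open Literature.Probability.RandomPlanarGeometry Literature.Probability.LatticeModels
  Literature.Probability.Percolation
open UpperHalfPlane (upperHalfPlaneSet)
open Literature.Probability.Percolation.TrackExchange
open Literature.Probability.LatticeModels.IsMedialExploration
open Summit.CriticalPhenomena.CardyFormulaZ2.Cruxes.LagHandOff.HittingTournament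
  (tIdx_lt_length dist_polyline_cv_le' forall_corner_not_mem_of_far
    dist_meshPoint_ge_of_mem_zdDiscreteArc exists_isTraversal_of_visit)
open scoped unitInterval Topology

local notation3 "ν[" b ", " v "]" => max |col v - col b| (hgtOf v - hgtOf b)
local notation3 "μ" => bondPercolation (zdGraph 2) half

/-! ### Bookkeeping: the point `z`, the eventual separation, the scales -/

/-- The midpoint `z = -(1+i)/2` of the hypotenuse lies on the free arc, at distance `≥ 1/8` from
the marked points and from the wired arc. -/
theorem touchExponent_z_far (D : DobrushinDomain) (hp0 : D.pt 0 = -1) (hp1 : D.pt 1 = -Complex.I)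
    (hA0 : D.arc 0 = segment ℝ (-1 : ℂ) 0 ∪ segment ℝ (0 : ℂ) (-Complex.I))
    (hA1 : D.arc 1 = segment ℝ (-Complex.I) (-1 : ℂ)) :
    (-(1 + Complex.I) / 2) ∈ D.arc 1 ∧ (∀ k : Fin 2, (1 / 8 : ℝ) ≤ dist (D.pt k) (-(1 + Complex.I) / 2)) ∧
      ∀ w ∈ D.arc 0, (1 / 8 : ℝ) ≤ dist w (-(1 + Complex.I) / 2) := by
  set z : ℂ := -(1 + Complex.I) / 2 with hz
  have him_le : ∀ w : ℂ, |(w - z).im| ≤ dist w z := fun w => by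
    rw [Complex.dist_eq]; exact Complex.abs_im_le_norm _
  have hre_le : ∀ w : ℂ, |(w - z).re| ≤ dist w z := fun w => by
    rw [Complex.dist_eq]; exact Complex.abs_re_le_norm _
  have hzre : z.re = -(1 / 2) := by norm_num [hz]
  have hzim : z.im = -(1 / 2) := by norm_num [hz]
  refine ⟨?_, ?_, ?_⟩
  · rw [hA1]
    exact ⟨1 / 2, 1 / 2, by norm_num, by norm_num, by norm_num, by rw [hz]; simp; ring⟩
  · intro k
    fin_cases k
    · show (1 / 8 : ℝ) ≤ dist (D.pt 0) z
      refine le_trans ?_ (him_le _)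
      rw [hp0, Complex.sub_im, hzim]; norm_num
    · show (1 / 8 : ℝ) ≤ dist (D.pt 1) z
      refine le_trans ?_ (hre_le _)
      rw [hp1, Complex.sub_re, hzre]; norm_num
  · intro w hw
    rw [hA0] at hw
    rcases hw with hw | hw
    · obtain ⟨a, b, -, -, -, rfl⟩ := hw
      refine le_trans ?_ (him_le _)
      rw [Complex.sub_im, hzim]; simp; norm_num
    · obtain ⟨a, b, -, -, -, rfl⟩ := hw
      refine le_trans ?_ (hre_le _)
      rw [Complex.sub_re, hzre]; simp; norm_num

/-- **Eventual separation along a discretisation family.** For a point `z` of `∂Δ` at distance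
`≥ 1/8` from the marked points and from the wired arc `arc 0`: for all small meshes the data are
admissible, the discrete marked points are at distance `≥ 3/32` and the sites of the discrete
wired arc at distance `≥ 3/64` from `z` (Hausdorff convergence of the marked points and of the
arc `A`, `dist_meshPoint_ge_of_mem_zdDiscreteArc`). -/
theorem touchExponent_eventually_far (D : DobrushinDomain) {E : ℝ → DiscreteDobrushin}
    (hE : ZdDiscretisationFamily D E) {z : ℂ} (hzf : z ∈ frontier D.carrier)
    (hpt : ∀ k : Fin 2, (1 / 8 : ℝ) ≤ dist (D.pt k) z) (hKfar : ∀ w ∈ D.arc 0, (1 / 8 : ℝ) ≤ dist w z) :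
    ∀ᶠ δ in 𝓝[>] (0 : ℝ), (E δ).IsZdAdmissible ∧
      (∀ p ∈ medialPoint (E δ).δ '' (E δ).zdABEdges, 3 * (1 / 8) / 4 ≤ dist p z) ∧
      (∀ v ∈ (E δ).zdArcA, 3 * (1 / 8) / 8 ≤ dist (meshPoint (E δ).δ v) z) := by
  have hK : (D.arc 0).Nonempty := ⟨_, D.pt_mem_arc_self 0⟩
  have hH0 : (0 : ENNReal) < ENNReal.ofReal (1 / 32) := ENNReal.ofReal_pos.2 (by norm_num)
  have h1 := hE.eventually_isZdAdmissible
  have h2 : ∀ᶠ δ in 𝓝[>] (0 : ℝ), hausdorffEDist (medialPoint δ '' (E δ).zdABEdges)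
      {D.pt 0, D.pt 1} < ENNReal.ofReal (1 / 32) :=
    hE.tendsto_zdABEdges.eventually (Iio_mem_nhds hH0)
  have h3 : ∀ᶠ δ in 𝓝[>] (0 : ℝ), hausdorffEDist (E δ).arcA (D.arc 0) < ENNReal.ofReal (1 / 32) :=
    hE.tendsto_arcA.eventually (Iio_mem_nhds hH0)
  filter_upwards [h1, h2, h3] with δ hadm hAB hH
  have hδeq : (E δ).δ = δ := hE.δ_eq δ
  have hΩ : (E δ).Ω = D.carrier := hE.Ω_eq δ
  refine ⟨hadm, fun p hp => ?_, fun v hv => ?_⟩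
  · rw [hδeq] at hp
    obtain ⟨w, hw, hpw⟩ := exists_edist_lt_of_hausdorffEDist_lt hp hAB
    rw [edist_lt_ofReal] at hpw
    have hwz : 1 / 8 ≤ dist w z := by
      simp only [mem_insert_iff, mem_singleton_iff] at hw
      rcases hw with rfl | rfl
      · exact hpt 0
      · exact hpt 1
    linarith [dist_triangle w p z, dist_comm p w]
  · have hzf' : z ∈ frontier (E δ).Ω := by rw [hΩ]; exact hzf
    have hKfar' : ∀ q ∈ D.arc 0, 1 / 8 ≤ dist z q := fun q hq => by
      rw [dist_comm]; exact hKfar q hq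
    have := dist_meshPoint_ge_of_mem_zdDiscreteArc hK hH hzf' (by norm_num : (1 : ℝ) / 32 < 1 / 8)
      hKfar' hv
    linarith

/-- **The scales.** With `R₁ = ⌈2(ε + 4δ)/δ⌉` and `R₂ = ⌊(1/64 - 4δ)/(2δ)⌋`: for
`0 < ε < 1/512` and `0 < δ ≤ ε ⊓ 1/3072 ⊓ 2ε/r₀`, one has `r₀ ≤ R₁ ≤ R₂`, `R₁/R₂ ≤ 2816 ε`, and the
two conversions used to place the ends of the arm below `R₁` and above `R₂`. -/
theorem touchExponent_scales {ε δ : ℝ} {r₀ : ℕ} (hr₀ : 1 ≤ r₀) (hε0 : 0 < ε) (hε1 : ε < 1 / 512)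
    (hδ : 0 < δ) (hδε : δ ≤ ε) (hδ1 : δ ≤ 1 / 3072) (hδr₀ : δ ≤ 2 * ε / r₀) :
    r₀ ≤ ⌈2 * (ε + 4 * δ) / δ⌉₊ ∧ ⌈2 * (ε + 4 * δ) / δ⌉₊ ≤ ⌊(1 / 64 - 4 * δ) / (2 * δ)⌋₊ ∧
      (0 : ℝ) < ⌊(1 / 64 - 4 * δ) / (2 * δ)⌋₊ ∧
      ((⌈2 * (ε + 4 * δ) / δ⌉₊ : ℝ) / ⌊(1 / 64 - 4 * δ) / (2 * δ)⌋₊) ≤ 2816 * ε ∧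
      (∀ d : ℝ, d ≤ ε + 4 * δ → 2 * d / δ ≤ ⌈2 * (ε + 4 * δ) / δ⌉₊) ∧
      (∀ M : ℝ, 1 / 64 - 4 * δ ≤ 2 * δ * M → (⌊(1 / 64 - 4 * δ) / (2 * δ)⌋₊ : ℝ) ≤ M) := by
  have hr₀pos : (0 : ℝ) < r₀ := by exact_mod_cast hr₀
  set R₁ : ℕ := ⌈2 * (ε + 4 * δ) / δ⌉₊ with hR₁
  set R₂ : ℕ := ⌊(1 / 64 - 4 * δ) / (2 * δ)⌋₊ with hR₂
  have hA0' : 0 ≤ 2 * (ε + 4 * δ) / δ := by positivity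
  have hB0' : 0 ≤ (1 / 64 - 4 * δ) / (2 * δ) := by
    apply div_nonneg <;> linarith
  have hR₁lo : 2 * (ε + 4 * δ) / δ ≤ R₁ := Nat.le_ceil _
  have hR₁hi : (R₁ : ℝ) < 2 * (ε + 4 * δ) / δ + 1 := Nat.ceil_lt_add_one hA0'
  have hR₂lo : (1 / 64 - 4 * δ) / (2 * δ) < R₂ + 1 := Nat.lt_floor_add_one _
  have hR₂hi : (R₂ : ℝ) ≤ (1 / 64 - 4 * δ) / (2 * δ) := Nat.floor_le hB0'
  have hA1' : 2 * (ε + 4 * δ) / δ + 1 = (2 * ε + 9 * δ) / δ := by field_simp; ring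
  have hB1' : (1 / 64 - 4 * δ) / (2 * δ) - 1 = (1 / 64 - 6 * δ) / (2 * δ) := by field_simp; ring
  have hr₀R₁ : r₀ ≤ R₁ := by
    have h1 : (r₀ : ℝ) ≤ 2 * ε / δ := by
      rw [le_div_iff₀ hδ]; rw [le_div_iff₀ hr₀pos] at hδr₀; linarith
    have h2 : 2 * ε / δ ≤ 2 * (ε + 4 * δ) / δ := by
      apply div_le_div_of_nonneg_right _ hδ.le; linarith
    exact_mod_cast (h1.trans h2).trans hR₁lo
  have h12 : R₁ ≤ R₂ := by
    have key : 2 * (ε + 4 * δ) / δ + 1 ≤ (1 / 64 - 4 * δ) / (2 * δ) - 1 := by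
      rw [hA1', hB1', div_le_div_iff₀ hδ (by positivity)]
      nlinarith
    have : (R₁ : ℝ) < R₂ + 1 := by linarith
    exact_mod_cast Nat.lt_succ_iff.1 (by exact_mod_cast this)
  have hR₁pos : (0 : ℝ) < R₁ := by
    have : (1 : ℝ) ≤ r₀ := by exact_mod_cast hr₀
    have : (r₀ : ℝ) ≤ R₁ := by exact_mod_cast hr₀R₁
    linarith
  have hR₂pos : (0 : ℝ) < R₂ := lt_of_lt_of_le hR₁pos (by exact_mod_cast h12)
  refine ⟨hr₀R₁, h12, hR₂pos, ?_, fun d hd => ?_, fun M hM => ?_⟩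
  · have hB'pos : 0 < (1 / 64 - 6 * δ) / (2 * δ) := by apply div_pos <;> linarith
    calc ((R₁ : ℝ) / R₂) ≤ ((2 * ε + 9 * δ) / δ) / ((1 / 64 - 6 * δ) / (2 * δ)) := by
          refine div_le_div₀ (by positivity) ?_ hB'pos ?_
          · rw [← hA1']; exact hR₁hi.le
          · rw [← hB1']; linarith
      _ = 2 * (2 * ε + 9 * δ) / (1 / 64 - 6 * δ) := by
          field_simp
      _ ≤ 2816 * ε := by
          rw [div_le_iff₀ (by linarith)]
          nlinarith [mul_le_mul_of_nonneg_left hδ1 hε0.le]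
  · refine le_trans ?_ hR₁lo
    rw [mul_div_assoc, mul_div_assoc]
    exact mul_le_mul_of_nonneg_left (div_le_div_of_nonneg_right hd hδ.le) (by norm_num)
  · refine hR₂hi.trans ?_
    rw [div_le_iff₀ (by positivity)]
    linarith

/-! ### The registered helper: the upper lattice touch bound -/

/-- **T4b `touchExponent_upperLatticeBound`** (registered helper for `stub_touchExponent`).
Conditional on Ikhlef–Ponsaing's Prop. 4.7 (`IkhlefPonsaingFirstPassage`): for the triangle
Dobrushin domain `(Δ; -1, -i)` (carrier `{re < 0, im < 0, re + im > -1}`, wired arc the two legs,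
free arc the hypotenuse) and every admissible `ℤ²`-discretisation family `E` of it, there are
`C` and `ε₀ > 0` such that for every `ε ∈ (0, ε₀)` and all small meshes `δ`, the probability that
the bond-`ℤ²` (`p = ½`) interface of `(Δ, E δ)` comes `ε`-close to the midpoint `-(1+i)/2` of the
hypotenuse is at most `C ε^{1/3}`. -/
theorem touchExponent_upperLatticeBound : Literature.Probability.Percolation.IkhlefPonsaingFirstPassage → ∀ (D : DobrushinDomain) (E : ℝ → DiscreteDobrushin), D.carrier = {w : ℂ | w.re < 0 ∧ w.im < 0 ∧ -1 < w.re + w.im} → D.pt 0 = -1 → D.pt 1 = -Complex.I → D.arc 0 = segment ℝ (-1 : ℂ) 0 ∪ segment ℝ (0 : ℂ) (-Complex.I) → D.arc 1 = segment ℝ (-Complex.I) (-1 : ℂ) → ZdDiscretisationFamily D E → ∃ C ε₀ : ℝ, 0 < ε₀ ∧ ∀ ε ∈ Set.Ioo 0 ε₀, ∀ᶠ δ in nhdsWithin (0 : ℝ) (Set.Ioi 0), (bondPercolation (zdGraph 2) half).real {ω | ∃ w ∈ (bondInterfaceIn D (E δ) ω).range, dist w (-(1 + Complex.I) / 2) <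 ε} ≤ C * ε ^ (1 / 3 : ℝ) := by
  intro hIP D E hcar hp0 hp1 hA0 hA1 hE
  obtain ⟨c, C, hc, r₀, hr₀, hT3⟩ := touchExponent_twoScaleArm hIP
  obtain ⟨hzarc, hpt, hKfar⟩ := touchExponent_z_far D hp0 hp1 hA0 hA1
  set z : ℂ := -(1 + Complex.I) / 2 with hz
  have hzf : z ∈ frontier D.carrier := D.arc_subset_frontier 1 hzarc
  refine ⟨C * (2816 : ℝ) ^ (1 / 3 : ℝ), 1 / 512, by norm_num, fun ε hε => ?_⟩
  obtain ⟨hε0, hε1⟩ := hε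
  -- eventual facts along the mesh filter
  have h4 : ∀ᶠ δ in 𝓝[>] (0 : ℝ), δ ≤ min (min ε (1 / 3072)) (2 * ε / r₀) :=
    mem_nhdsWithin_of_mem_nhds (Iic_mem_nhds (by positivity))
  have h5 : ∀ᶠ δ in 𝓝[>] (0 : ℝ), 0 < δ := self_mem_nhdsWithin
  filter_upwards [touchExponent_eventually_far D hE hzf hpt hKfar, h4, h5] with δ hfar hδle hδ
  obtain ⟨hadm, hends, hside⟩ := hfar
  have hδε : δ ≤ ε := (hδle.trans (min_le_left _ _)).trans (min_le_left _ _)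
  have hδ1 : δ ≤ 1 / 3072 := (hδle.trans (min_le_left _ _)).trans (min_le_right _ _)
  have hδr₀ : δ ≤ 2 * ε / r₀ := hδle.trans (min_le_right _ _)
  have hδeq : (E δ).δ = δ := hE.δ_eq δ
  have hΩ : (E δ).Ω = D.carrier := hE.Ω_eq δ
  -- lattice scales
  obtain ⟨hr₀R₁, h12, hR₂pos, hratio, hend1, hend2⟩ :=
    touchExponent_scales hr₀ hε0 hε1 hδ hδε hδ1 hδr₀
  set R₁ : ℕ := ⌈2 * (ε + 4 * δ) / δ⌉₊ with hR₁
  set R₂ : ℕ := ⌊(1 / 64 - 4 * δ) / (2 * δ)⌋₊ with hR₂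
  set hh : ℤ := ⌊-1 / δ⌋ + 1 with hhh
  set b : Site 2 := ![⌊-1 / (2 * δ)⌋, ⌊-1 / δ⌋ + 1 - ⌊-1 / (2 * δ)⌋] with hbdef
  have hb : hgtOf b = hh := by
    simp only [hgtOf, hbdef, hhh, Matrix.cons_val_zero, Matrix.cons_val_one, Matrix.cons_val_fin_one]
    ring
  have hbz : dist (meshPoint δ b) z ≤ 3 * δ := touchExponent_dist_base_le hδ
  -- the T3 bound at level `0`, base point `b' = b - (hh, 0)`
  set t : Site 2 := ![hh, 0] with htdef
  have ht : hgtOf t = hh := by simp [hgtOf, htdef]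
  set b' : Site 2 := b - t with hb'def
  have hbt : b' + t = b := sub_add_cancel b t
  have hb' : hgtOf b' = 0 := by
    have : hgtOf b' = hgtOf b - hgtOf t := by simp only [hgtOf, hb'def, Pi.sub_apply]; ring
    rw [this, hb, ht, sub_self]
  obtain ⟨-, hT⟩ := hT3 b' R₁ R₂ (by rw [hb']) (by rw [hb']; norm_num) hr₀R₁ h12
  have hC : 0 ≤ C := by
    have hx : 0 < ((R₁ : ℝ) / R₂) ^ (1 / 3 : ℝ) := by
      have hR₁pos : (0 : ℝ) < R₁ := by
        have h1 : (1 : ℝ) ≤ r₀ := by exact_mod_cast hr₀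
        have h2 : (r₀ : ℝ) ≤ R₁ := by exact_mod_cast hr₀R₁
        linarith
      positivity
    have : 0 ≤ C * (((R₁ : ℝ) / R₂) ^ (1 / 3 : ℝ)) := measureReal_nonneg.trans hT
    nlinarith
  have hfinal : C * ((R₁ : ℝ) / R₂) ^ (1 / 3 : ℝ) ≤ C * (2816 : ℝ) ^ (1 / 3 : ℝ) * ε ^ (1 / 3 : ℝ) := by
    rw [mul_assoc, ← Real.mul_rpow (by norm_num) hε0.le]
    exact mul_le_mul_of_nonneg_left (Real.rpow_le_rpow (by positivity) hratio (by norm_num)) hC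
  -- the touch event is contained, almost surely, in the two-scale arm event at level `hh`
  have hS : ∀ y ∈ meshDomain D.carrier δ ∩ {y | dist (meshPoint δ y) z ≤ 1 / 8 / 8 + δ},
      hh ≤ hgtOf y := fun y hy => touchExponent_level_le_hgtOf hδ (by
    rw [← hcar]; exact (mem_meshVertices_iff).1 (meshDomain_subset_meshVertices _ _ hy.1))
  have hincl : ∀ᵐ ω ∂(μ), ω ∈ {ω | ∃ w ∈ (bondInterfaceIn D (E δ) ω).range, dist w z < ε} →
      ω ∈ openCrossing {y : Site 2 | hh ≤ hgtOf y ∧ (R₁ : ℤ) ≤ ν[b, y] ∧ ν[b, y] ≤ (R₂ : ℤ)}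
        {y : Site 2 | ν[b, y] = (R₁ : ℤ)} {y : Site 2 | ν[b, y] = (R₂ : ℤ)} := by
    filter_upwards [ae_subset_edgeSet (zdGraph 2) half] with ω hω hev
    obtain ⟨w, hw, hwz⟩ := hev
    rw [range_bondInterfaceIn] at hw
    obtain ⟨u, rfl⟩ := hw
    obtain ⟨v, w', hv, hw', hconn⟩ := touchExponent_inDomainArm_of_visit hadm
      (by rw [hδeq]; linarith : (E δ).δ ≤ (1 / 8) / 64) hends hside (ρ' := ε) (by linarith)
      ⟨u, hwz.le⟩
    rw [hδeq] at hv hw' hconn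
    rw [hΩ] at hconn
    have hwS : w' ∈ meshDomain D.carrier δ ∩ {y | dist (meshPoint δ y) z ≤ 1 / 8 / 8 + δ} := by
      obtain ⟨-, h, -⟩ := hconn
      exact h
    -- the two ends in the half-plane norm
    have hvν : ν[b, v] ≤ (R₁ : ℤ) := by
      have h1 := touchExponent_norm_le_dist hδ b v
      have h2 : dist (meshPoint δ v) (meshPoint δ b) ≤ ε + 4 * δ := by
        linarith [dist_triangle (meshPoint δ v) z (meshPoint δ b), dist_comm (meshPoint δ b) z]
      exact_mod_cast h1.trans (hend1 _ h2)
    have hwν : (R₂ : ℤ) ≤ ν[b, w'] := by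
      have hyb : hgtOf b ≤ hgtOf w' := by rw [hb]; exact hS w' hwS
      have h1 := touchExponent_dist_le_norm hδ hyb
      have h2 : 1 / 64 - 4 * δ ≤ dist (meshPoint δ w') (meshPoint δ b) := by
        norm_num at hw'
        linarith [dist_triangle (meshPoint δ w') (meshPoint δ b) z]
      exact_mod_cast hend2 _ (h2.trans h1)
    exact touchExponent_clip_halfAnnulus hω hS (by exact_mod_cast h12) hvν hwν hconn
  -- conclusion
  calc (μ).real {ω | ∃ w ∈ (bondInterfaceIn D (E δ) ω).range, dist w z < ε}
      ≤ (μ).real (openCrossing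
          {y : Site 2 | hh ≤ hgtOf y ∧ (R₁ : ℤ) ≤ ν[b, y] ∧ ν[b, y] ≤ (R₂ : ℤ)}
          {y : Site 2 | ν[b, y] = (R₁ : ℤ)} {y : Site 2 | ν[b, y] = (R₂ : ℤ)}) :=
        ENNReal.toReal_mono (measure_ne_top _ _) (measure_mono_ae hincl)
    _ = (μ).real (openCrossing
          {y : Site 2 | 0 ≤ hgtOf y ∧ (R₁ : ℤ) ≤ ν[b', y] ∧ ν[b', y] ≤ (R₂ : ℤ)}
          {y : Site 2 | ν[b', y] = (R₁ : ℤ)} {y : Site 2 | ν[b', y] = (R₂ : ℤ)}) := by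
        rw [← hbt, ← ht]
        exact touchExponent_real_shift_level t b' R₁ R₂
    _ ≤ C * ((R₁ : ℝ) / R₂) ^ (1 / 3 : ℝ) := hT
    _ ≤ C * (2816 : ℝ) ^ (1 / 3 : ℝ) * ε ^ (1 / 3 : ℝ) := hfinal

end Summit.CriticalPhenomena.CardyFormulaZ2.Theorems.SymmetryUpgradeR.SwallowingSkeleton

end
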